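import Literature.NumberTheory.Automorphic.Liu2021.Def411WeilCarriersIrreducibleOfLemD1
import HarnessLib

/-!
# [Liu2021, Def. 4.11]'s «irreducible» for the constructed `ω(μ, ε, χ)`: local splittings ADAPTED to the global one

Topic `NumberTheory/Automorphic/Liu2021`.  KERNEL ONLY: theorems; no definition, no record, no named fact, no `sorry`.

[Liu2021, Def. 4.11 (l. 2092–2096)] DEFINES the adèlic oscillator representation as the restricted tensor product of the
local ones, `ω(μ, ε, χ) := ⊗'_v ω(μ_v, ε_v, χ_v)`: the global splitting IS the product of the local splittings `ι_{μ_v}`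
([Liu2021, App. D §D.1 Step 2 (l. 5219)]).  On the tree's carriers this is the hypothesis `h0` below: the compatible
splitting `s_{lineOf ε}` of the pair `(V, ⟨lineOf ε⟩)`, restricted to `U(J_V)(𝔸_f) × U(J_W)(𝔸_f)`, EQUALS the local
reference section `s₀(𝓢)` assembled from the local splittings `𝓢` (`WeilCoinv.localRefSection`) — no twist.  Then the
decisive central character of `Def411WeilCarriersIrreducibleOfLemD1` is the datum's own automorphic character `χ`
(`Chi F E c`), and the END displays' `hirr` follows from the two printed local inputs AT `χ`:

* `Def411WeilCarriers.rho_isIrreducible_of_lemD1_local_adapted` — (i) for every `v`, the `U(J_V ⊗ (lineOf ε))(F_v)`-action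
  on `Coinv(ω_v ∘ (u ↦ u·1_n), χ_v)` is irreducible and admissible ([Liu2021, App. D Lem. D.1, first sentence l. 5227]
  «Then `ω(μ, ε, χ)` is irreducible and admissible», App. D's local notation read at `v`), (ii) the class of `1_{𝒪_vⁿ}` is
  non-zero off a finite set (Def. 4.11's `⊗'`, «unramified for all but finitely many `v`») ⟹ `(rho … ι ε χ).IsIrreducible`;
* `Def411WeilCarriers.rho_isIrreducible_of_irreducibleAdmissible_local_adapted` (`n ≥ 3`) — the same with (i) in the
  tree's Lem.-D.1 RECORD currency `LocalOscillatorDatum.IrreducibleAdmissible` of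
  `ofCentralChar (𝓢.omegaLoc v) (u ↦ u·1_n) _ χ_v n _`.

Here `χ_v = localCharOfCenter … χ.1 v` are the local components of `χ` (`χ = ∏_v χ_v`, `coe_charOfCenter_eq_finprod`).
Nothing of [Liu2021] is asserted; HC_CM is not mentioned by this file.

## References
* [Liu2021] Y. Liu, Camb. J. Math. 9 (2021) = arXiv:2102.11518: Def. 4.11 (l. 2083–2097), App. D §D.1 Steps 1∕2∕3
  (l. 5217∕5219∕5221), Lem. D.1 (l. 5227; (1) l. 5229 for non-vanishing).
* [Flath1979] D. Flath, PSPM 33 (1979) part 1, Thm. 2, Ex. 2.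
* [MoeglinVignerasWaldspurger1987] C. Mœglin, M.-F. Vignéras, J.-L. Waldspurger, LNM 1291, Chap. 2 II.1 (B) (twists
  of sections by characters).
-/

set_option autoImplicit false

noncomputable section

open scoped Matrix Kronecker TensorProduct Classical RestrictedProduct
open NumberField NumberField.mixedEmbedding IsDedekindDomain Filter Set
open Literature.NumberTheory.Automorphic Literature.NumberTheory.Automorphic.UnitaryGroup
open Literature.NumberTheory.Weil1964 Literature.RepresentationTheory
open Literature.RepresentationTheory.HeisenbergGroup
open Literature.NumberTheory Literature.NumberTheory.GelbartRogawski1991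
open Literature.NumberTheory.GelbartRogawski1991.UnitaryDualPair
open Literature.NumberTheory.GelbartRogawski1991.UnitaryDualPair.WeilCoinv

namespace Literature.NumberTheory.Automorphic.Liu2021.Def411WeilCarriers

variable (F E : Type) [Field F] [NumberField F] [Field E] [NumberField E] [Algebra F E]
variable (c : E ≃ₐ[F] E) (N : ℕ) {n : ℕ} (e : Fin N × Fin 1 ≃ Fin n)
variable (JV : Matrix (Fin N) (Fin N) E) {TV : Matrix (Fin N) (Fin N) F}
variable [Algebra.IsQuadraticExtension F E] {δ : E} (hcδ : c δ = -δ) (hδ : δ ≠ 0) {d : F}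
  (hd : δ * δ = algebraMap F E d) (hV : TV.IsSymm) (hVd : IsUnit TV.det) (hJV : JV = TV.map (algebraMap F E))
variable {s : ∀ a : Fˣ, UnitaryGroup.adelicPair F E c N 1 JV (JW F E a) →* adelicMpCont F (Fin n) (adelicGram F e TV (TW F a))}
  (hs : ∀ a : Fˣ, (splittingDatum F E c N 1 e JV (JW F E a) hcδ hδ hd hV (isSymm_TW F a) hVd (isUnit_det_TW F a) hJV
    (JW_eq F E a)).IsCompatible (s a))
variable (ε : Eps F d) (χ : Chi F E c)
variable (𝓢 : LocalSplitting.FinLocalSplittings F E c n hcδ hδ hd (gram F e TV (TW F (lineOf F d ε)))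
    (isSymm_gram F e hV (isSymm_TW F (lineOf F d ε)))
    (reindex_kronecker_eq_gram_map F E e hJV (JW_eq F E (lineOf F d ε))))
variable {G : Type*} [Group G] [TopologicalSpace G] {ι : G →* UnitaryGroup.finAdelic F E c N JV}
  (hι : Function.Surjective ι)

omit [TopologicalSpace G] in
include hι in
/-- **The END displays' `hirr` from the two printed local inputs at the datum's character `χ`, for local splittings
ADAPTED to the global one** ([Liu2021, Def. 4.11]: `ω(μ, ε, χ) := ⊗'_v ω(μ_v, ε_v, χ_v)` — the global splitting is the
product of the local `ι_{μ_v}`).  `h0`: `s_{lineOf ε}` restricted to `U(J_V)(𝔸_f) × U(J_W)(𝔸_f)` equals the local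
reference section `s₀(𝓢)`; (i) `hirr`/`hadm`: every local central quotient `Coinv(ω_v ∘ (u ↦ u·1_n), χ_v)` is an
irreducible admissible representation of `U(J_V ⊗ (lineOf ε))(F_v)` ([Liu2021, App. D Lem. D.1, first sentence
l. 5227], read at `v`); (ii) `hx₀N`: the class of `1_{𝒪_vⁿ}` is non-zero off a finite `S₁`.  THEN `rho … ι ε χ` is
irreducible (`ι` onto).  PROOF: `h0` is the twist equation with the trivial character, so
`isIrreducible_weilCoinv_iff_omega_center` applies with `χ'' = χ_W`, whose pull-back along `u ↦ u·1_W` is `χ`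
(`lineChar_finAdelicCenter`); conclude by `omega_center_isIrreducible_of_local` at `χ₁ = χ` (continuous: `χ.2.1`).
[cite: Liu2021, Def. 4.11 (l. 2092–2096), App. D §D.1 Step 2 (l. 5219), Step 3 (l. 5221), Lem. D.1 (l. 5227); Flath1979, Theorem 2 / Example 2; MoeglinVignerasWaldspurger1987, Chap. 2 II.1 (B)] -/
theorem rho_isIrreducible_of_lemD1_local_adapted
    (h0 : (pairSmall₁ F E c N 1 e JV (JW F E (lineOf F d ε)) (s (lineOf F d ε))).comp
        (finPairToAdelic F E c N 1 JV (JW F E (lineOf F d ε))) =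
      localRefSection F E c N 1 e JV (JW F E (lineOf F d ε)) hcδ hδ hd hV (isSymm_TW F _) hJV (JW_eq F E _) 𝓢)
    (hirr : ∀ v, (TwistedCoinv.rep (localCharOfCenter F E c (JW F E (lineOf F d ε)) (JW_apply_ne_zero F E _) χ.1 v)
      (𝓢.omegaLoc v)
      (commute_omegaLoc_localCenter F E c N e JV (JW F E (lineOf F d ε)) hcδ hδ hd hV (isSymm_TW F _) hJV
        (JW_eq F E _) (JW_apply_ne_zero F E _) 𝓢 v)).IsIrreducible)
    (hadm : ∀ v, (TwistedCoinv.rep (localCharOfCenter F E c (JW F E (lineOf F d ε)) (JW_apply_ne_zero F E _) χ.1 v)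
      (𝓢.omegaLoc v)
      (commute_omegaLoc_localCenter F E c N e JV (JW F E (lineOf F d ε)) hcδ hδ hd hV (isSymm_TW F _) hJV
        (JW_eq F E _) (JW_apply_ne_zero F E _) 𝓢 v)).IsAdmissible)
    {S₁ : Finset (HeightOneSpectrum (𝓞 F))}
    (hx₀N : ∀ v ∉ S₁,
      TwistedCoinv.mk (show Representation ℂ (UnitaryGroup.localPi E c 1 (JW F E (lineOf F d ε)) v) _ from
          (𝓢.omegaLoc v).comp (localCenter E c n (Matrix.reindex e e (JV ⊗ₖ JW F E (lineOf F d ε))) (JW F E (lineOf F d ε))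
            (JW_apply_ne_zero F E _) v))
        (localCharOfCenter F E c (JW F E (lineOf F d ε)) (JW_apply_ne_zero F E _) χ.1 v) (unitVec F (Fin n) v) ≠ 0) :
    (rho F E c N e JV hcδ hδ hd hV hVd hJV hs ι ε χ).IsIrreducible := by
  -- `h0` as the twist equation with the trivial character
  have hχtw : (pairSmall₁ F E c N 1 e JV (JW F E (lineOf F d ε)) (s (lineOf F d ε))).comp
        (finPairToAdelic F E c N 1 JV (JW F E (lineOf F d ε))) =
      adelicMpCont.twist F (Fin N × Fin 1) _
        (localRefSection F E c N 1 e JV (JW F E (lineOf F d ε)) hcδ hδ hd hV (isSymm_TW F _) hJV (JW_eq F E _) 𝓢)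
        (1 : _ →* ℂˣ) :=
    h0.trans (MonoidHom.ext fun γ => (adelicMpCont.twist_eq_of_eq_one _ _ (MonoidHom.one_apply γ)).symm)
  -- the pull-back of `χ_W` along `u ↦ u·1_W` is `χ`
  have hχeq : (lineChar F E c (lineOf F d ε) χ.1).comp (UnitaryGroup.finAdelicCenter F E c 1 (JW F E (lineOf F d ε))) =
      χ.1 :=
    MonoidHom.ext fun u => by rw [MonoidHom.comp_apply, lineChar_finAdelicCenter]
  refine (Representation.isIrreducible_comp_iff_of_surjective _ ι hι).2 ?_
  refine (isIrreducible_weilCoinv_iff_omega_center F E c N e JV (JW F E (lineOf F d ε)) hcδ hδ hd hV (isSymm_TW F _)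
    hVd (isUnit_det_TW F _) hJV (JW_eq F E _) 𝓢 (hs (lineOf F d ε)) hχtw
    (χ'' := lineChar F E c (lineOf F d ε) χ.1) (fun u => ?_) (JW_apply_ne_zero F E _)).2 ?_
  · rw [MonoidHom.one_apply, one_mul]
  · rw [hχeq]
    exact omega_center_isIrreducible_of_local F E c N e JV (JW F E (lineOf F d ε)) hcδ hδ hd hV (isSymm_TW F _) hJV
      (JW_eq F E _) (JW_apply_ne_zero F E _) 𝓢 χ.2.1 hx₀N hirr hadm

open scoped IsMulCommutative in
omit [TopologicalSpace G] in
include hι in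
/-- **The same in the tree's Lem.-D.1 RECORD currency** (`n ≥ 3`, local splittings adapted to the global one):
`LocalOscillatorDatum.IrreducibleAdmissible` of `ofCentralChar (𝓢.omegaLoc v) (u ↦ u·1_n) _ χ_v n _` at every `v`
([Liu2021, App. D Lem. D.1, first sentence l. 5227; non-zero as `n ≥ 3`, (1) l. 5229]) + the survival of `1_{𝒪_vⁿ}` off
a finite set ⟹ `(rho … ι ε χ).IsIrreducible`.
[cite: Liu2021, Def. 4.11 (l. 2092–2096), App. D §D.1 Step 2 (l. 5219), Step 3 (l. 5221), Lem. D.1 (l. 5227; (1) l. 5229 for non-vanishing); Flath1979, Theorem 2 / Example 2] -/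
theorem rho_isIrreducible_of_irreducibleAdmissible_local_adapted (hn : 3 ≤ n)
    (h0 : (pairSmall₁ F E c N 1 e JV (JW F E (lineOf F d ε)) (s (lineOf F d ε))).comp
        (finPairToAdelic F E c N 1 JV (JW F E (lineOf F d ε))) =
      localRefSection F E c N 1 e JV (JW F E (lineOf F d ε)) hcδ hδ hd hV (isSymm_TW F _) hJV (JW_eq F E _) 𝓢)
    (hD1 : ∀ v, (Literature.RepresentationTheory.Liu2021.LocalOscillatorDatum.ofCentralChar (𝓢.omegaLoc v)
        (localCenter E c n (Matrix.reindex e e (JV ⊗ₖ JW F E (lineOf F d ε))) (JW F E (lineOf F d ε))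
          (JW_apply_ne_zero F E _) v)
        (localCenter_mem_center F E c (JW F E (lineOf F d ε)) n (Matrix.reindex e e (JV ⊗ₖ JW F E (lineOf F d ε)))
          (JW_apply_ne_zero F E _) v)
        (localCharOfCenter F E c (JW F E (lineOf F d ε)) (JW_apply_ne_zero F E _) χ.1 v) n
        (Nat.le_of_succ_le hn)).IrreducibleAdmissible)
    {S₁ : Finset (HeightOneSpectrum (𝓞 F))}
    (hx₀N : ∀ v ∉ S₁,
      TwistedCoinv.mk (show Representation ℂ (UnitaryGroup.localPi E c 1 (JW F E (lineOf F d ε)) v) _ from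
          (𝓢.omegaLoc v).comp (localCenter E c n (Matrix.reindex e e (JV ⊗ₖ JW F E (lineOf F d ε))) (JW F E (lineOf F d ε))
            (JW_apply_ne_zero F E _) v))
        (localCharOfCenter F E c (JW F E (lineOf F d ε)) (JW_apply_ne_zero F E _) χ.1 v) (unitVec F (Fin n) v) ≠ 0) :
    (rho F E c N e JV hcδ hδ hd hV hVd hJV hs ι ε χ).IsIrreducible :=
  rho_isIrreducible_of_lemD1_local_adapted F E c N e JV hcδ hδ hd hV hVd hJV hs ε χ 𝓢 hι h0
    (fun v => (twistedCoinv_isIrreducible_and_isAdmissible_of_irreducibleAdmissible F E c N e JV (JW F E (lineOf F d ε))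
      hcδ hδ hd hV (isSymm_TW F _) hJV (JW_eq F E _) (JW_apply_ne_zero F E _) 𝓢 hn v _ (hD1 v)).1)
    (fun v => (twistedCoinv_isIrreducible_and_isAdmissible_of_irreducibleAdmissible F E c N e JV (JW F E (lineOf F d ε))
      hcδ hδ hd hV (isSymm_TW F _) hJV (JW_eq F E _) (JW_apply_ne_zero F E _) 𝓢 hn v _ (hD1 v)).2)
    hx₀N

end Literature.NumberTheory.Automorphic.Liu2021.Def411WeilCarriers

end
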